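import Summits.BirchSwinnertonDyer.BirchSwinnertonDyer.Theses.EdixhovenFibreFiveSeven
import Summits.BirchSwinnertonDyer.BirchSwinnertonDyer.Theses.TeichmullerTwistDescent
import Summits.BirchSwinnertonDyer.BirchSwinnertonDyer.Theorems.EdixhovenFibreFiveSevenKatoNeronTwistedSymbolSumIntegrality
import Summits.BirchSwinnertonDyer.BirchSwinnertonDyer.Theorems.ManinLocalTwoThreeStevensNaturalTes75
import Summits.BirchSwinnertonDyer.BirchSwinnertonDyer.Theorems.EdixhovenFibreFiveSevenStarredOptimalManinUnitFiveSevenCdtThm1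
import HarnessLib

/-!
# The PUB bundle `KatoNeronAndCremonaFacts` (stmt-BirchSwinnertonDyer-23789; routes EdixhovenFibreFiveSeven and
# TeichmullerTwistDescent) follows from MODULARITY ALONE — F″ is a theorem, Cremona's range is Manin's conjecture
# modulo {CDT ✓, modularity}

Route `EdixhovenFibreFiveSeven` (cell `pub/bsd-wall`, seat `bsd-line-edix-p1` g43), `--supports stmt-BirchSwinnertonDyer-23789`.
The bundle `KatoNeronAndCremonaFacts = F″ ∧ Cremona` is the binder `hPK` of BOTH deciding theorems
(`Theses.EdixhovenFibreFiveSeven.closes`, `Theses.TeichmullerTwistDescent.closes`), next to the binder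
`hP : PublishedInputsAdditiveKoly` whose sixth conjunct is the Modularity theorem `exists_isNewformOf`.  This file records
that `hPK` carries NO weight beyond `hP`:

* F″ = `kato_neron_isIntegral_twistedSymbolSum_of_additive_five_le` is the tree theorem `…_holds` (p829166, this seat);
* Cremona's range `cremona_abs_maninConstant_eq_one_of_level_le_500000` (`|c₀| = 1` for every lattice-optimal `X₀(N′)`-datum
  at every LEVEL `N′ ≤ 5·10⁵` — typed at an arbitrary level, so «level = conductor» is needed) is the `N′ ≤ 5·10⁵` shadow of
  the conjecture leaf `ManinConstantOne`, which the tree proves modulo {CDT, modularity}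
  (`maninLocalTwoThree_maninConstantOne_of_CDT_of_modularity`, cell bsd-f2-manin) with CDT discharged
  (`calegariDimitrovTang2025_unboundedDenominators_holds`, line `cdt_thm1` of K★): `cremona_…_of_modularity`;
* hence `katoNeronAndCremonaFacts_of_modularity : exists_isNewformOf → KatoNeronAndCremonaFacts` and
  `katoNeronAndCremonaFacts_of_publishedInputs : PublishedInputsAdditiveKoly → KatoNeronAndCremonaFacts` for both routes
  (planner datum: `hPK := katoNeronAndCremonaFacts_of_publishedInputs hP` in either `closes`).

HONEST STATUS.  CONDITIONAL on the Modularity theorem as typed (`exists_isNewformOf`, cite-only); UDC-dependent (audit (P†)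
pending); the item 23789 stays OPEN as filed (its own signature asserts Cremona's fact outright).  BSD is proved for no curve;
Manin's conjecture is NOT announced (the unconditional rung `ManinConstantOneRung`, stmt-22445, is open: level = conductor).
[cite: CesnaviciusNeururerSaha2023, §1 p. 2 (ref. [Cre22])] [cite: CalegariDimitrovTang2025, Thm. 1.0.1] [cite: BCDTJAMS2001, Thm. A]
-/

set_option autoImplicit false
-- the Theorems namespace of this sub repeats the summit name by design (D-0017 nested layout)
set_option linter.dupNamespace false

noncomputable section

open WeierstrassCurve Literature.NumberTheory.EllipticCurves Literature.NumberTheory.EllipticCurves.ModularForms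

namespace Summit.BirchSwinnertonDyer.BirchSwinnertonDyer.Theorems

/-- **Cremona's range fact ⟸ modularity**: `|c₀| = 1` for every lattice-optimal `X₀(N′)`-datum with `N′ ≤ 5·10⁵` is the
shadow of `ManinConstantOne`, a tree theorem modulo {CDT ✓, modularity}.  CONDITIONAL on `exists_isNewformOf`; UDC-dependent.
[cite: CesnaviciusNeururerSaha2023, §1 p. 2 (ref. [Cre22])] [cite: CalegariDimitrovTang2025, Thm. 1.0.1] -/
theorem cremona_abs_maninConstant_eq_one_of_level_le_500000_of_modularity (hnf : exists_isNewformOf) :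
    cremona_abs_maninConstant_eq_one_of_level_le_500000 :=
  fun W' _ _ _ _ D' hopt _ ↦
    maninLocalTwoThree_maninConstantOne_of_CDT_of_modularity calegariDimitrovTang2025_unboundedDenominators_holds hnf
      W' D' hopt

/-- **EF57's bundle `KatoNeronAndCremonaFacts` (stmt-BirchSwinnertonDyer-23789) ⟸ modularity**: F″ is the theorem
`kato_neron_isIntegral_twistedSymbolSum_of_additive_five_le_holds`, Cremona's range is `cremona_…_of_modularity`.  CONDITIONAL;
the item stays open as filed. [cite: BCDTJAMS2001, Thm. A] [cite: Kato2004Asterisque, Thm. 9.7 (p. 189)] -/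
theorem EdixhovenFibreFiveSeven.katoNeronAndCremonaFacts_of_modularity (hnf : exists_isNewformOf) :
    Summit.BirchSwinnertonDyer.BirchSwinnertonDyer.Theses.EdixhovenFibreFiveSeven.KatoNeronAndCremonaFacts :=
  ⟨kato_neron_isIntegral_twistedSymbolSum_of_additive_five_le_holds,
    cremona_abs_maninConstant_eq_one_of_level_le_500000_of_modularity hnf⟩

/-- **EF57: `hPK` from `hP`** — the bundle `KatoNeronAndCremonaFacts` from the bundle `PublishedInputsAdditiveKoly` (stmt-20137; its sixth
conjunct is `exists_isNewformOf`).  Planner datum for `Theses.EdixhovenFibreFiveSeven.closes`.  CONDITIONAL (hypothesis bundle).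
[cite: BCDTJAMS2001, Thm. A] -/
theorem EdixhovenFibreFiveSeven.katoNeronAndCremonaFacts_of_publishedInputs
    (hP : Summit.BirchSwinnertonDyer.BirchSwinnertonDyer.Theses.EdixhovenFibreFiveSeven.PublishedInputsAdditiveKoly) :
    Summit.BirchSwinnertonDyer.BirchSwinnertonDyer.Theses.EdixhovenFibreFiveSeven.KatoNeronAndCremonaFacts :=
  EdixhovenFibreFiveSeven.katoNeronAndCremonaFacts_of_modularity hP.2.2.2.2.2.1

/-- **TTD's bundle `KatoNeronAndCremonaFacts` (same item 23789, route TeichmullerTwistDescent) ⟸ modularity** (the two routes'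
bundles have identical bodies).  CONDITIONAL; the item stays open as filed. [cite: BCDTJAMS2001, Thm. A] -/
theorem TeichmullerTwistDescent.katoNeronAndCremonaFacts_of_modularity (hnf : exists_isNewformOf) :
    Summit.BirchSwinnertonDyer.BirchSwinnertonDyer.Theses.TeichmullerTwistDescent.KatoNeronAndCremonaFacts :=
  ⟨kato_neron_isIntegral_twistedSymbolSum_of_additive_five_le_holds,
    cremona_abs_maninConstant_eq_one_of_level_le_500000_of_modularity hnf⟩

/-- **TTD: `hPK` from `hP`** — planner datum for `Theses.TeichmullerTwistDescent.closes` (`hPK := … hP`).  CONDITIONAL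
(hypothesis bundle). [cite: BCDTJAMS2001, Thm. A] -/
theorem TeichmullerTwistDescent.katoNeronAndCremonaFacts_of_publishedInputs
    (hP : Summit.BirchSwinnertonDyer.BirchSwinnertonDyer.Theses.TeichmullerTwistDescent.PublishedInputsAdditiveKoly) :
    Summit.BirchSwinnertonDyer.BirchSwinnertonDyer.Theses.TeichmullerTwistDescent.KatoNeronAndCremonaFacts :=
  TeichmullerTwistDescent.katoNeronAndCremonaFacts_of_modularity hP.2.2.2.2.2.1

end Summit.BirchSwinnertonDyer.BirchSwinnertonDyer.Theorems

end
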